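import Mathlib
import HarnessLib
import HarnessLib.Audit
import Summits.ResolutionOfSingularities.Statement
import Summits.ResolutionOfSingularities.ResolutionOfSingularities.Theorems.CyclicCoversAssembly
import HarnessLib.Audit.Status.Attr

/-!
Route: CyclicCovers

PIVOT (tenure g2, 2026-08-15; supersedes the absolute-form thesis of rev <= 4, whose items
CycliccoversThesis/Rellu/RelluToLu/Patching/LuasLocalModel stay in the file as SUPPORT = dominated
special cases, nobody should be seated on them). It suffices to show, for every prime p, Abhyankar's
ramification-theoretic strategy made dimension-free and RELATIVE, with its two hidden inputs named:
(AsAscentRel_p) relative local uniformization ASCENDS along degree-p Galois (Artin-Schreier)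
extensions L/K of finitely generated fields over k, char k = p — if every f.g. k-subalgebra of O ∩ K
is dominated by a regular one AND regular models of O ∩ K admit local
principalisation/monomialisation of ideals along the valuation, then every f.g. k-subalgebra R of
the valuation ring O of L is dominated by a f.g. A ⊆ O, Frac A = L, regular at the centre;
(LuAlphaPTorsor_p, shared with route Valuative) the same one step up a degree-p purely inseparable
extension t^p = a over a base regular at the centre; (EluRegular_p) EMBEDDED local uniformization =
local principalisation along a valuation in REGULAR local rings essentially of finite type over k:
given A0 ⊆ O f.g., Frac A0 = K, regular at the centre, nonzero ideals I_1..I_m of A0 and f with f^n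
∈ each I_j, there is a f.g. A ⊇ A0 inside O, regular at the centre, Spec A → Spec A0 an open
immersion over D(f), and a regular system of parameters u of A at the centre in which every I_j
becomes a principal MONOMIAL ideal; (AbhyankarReduction: AsAscentRel → EluRegular → ∀ p prime,
LuAlphaPTorsor_p → LUrel_p — the two new sibling decls referenced by name, 0641's body expanded)
these three imply relative local uniformization LUrel_p for all f.g. K/k, all valuation rings O ⊇ k,
all f.g. R ⊆ O (Cossart-Piltant 2008 Thm 7.2 with '3' erased: transcendence basis, separable closure
+ PI tower, Galois closure, Krull splitting/inertia/ramification fields, etale ascent, tame abelian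
ascent, p-group composition series into degree-p Galois steps, tame push-down); (PatchingRel_p,
shared with route Valuative) LUrel_p → ResolutionInChar p. The deciding theorem is pure logic:
closes (hAS : AsAscentRel) (hPI : LuAlphaPTorsor) (hElu : EluRegular) (hRed : AbhyankarReduction)
(hPatch : PatchingRel) : ResolutionOfSingularities := fun p hp ↦ hPatch p hp (hRed hAS hElu p hp
(hPI p hp)) via ResolutionOfSingularities_iff.
Lean: AsAscentRel ∧ LuAlphaPTorsor ∧ EluRegular ∧ AbhyankarReduction ∧ PatchingRel   -- the five
`def … : Prop` of this file (each ∀ p, p.Prime → …; pure commutative algebra over Mathlib's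
ValuationSubring / Subalgebra.FG / Localization.AtPrime / IsRegularLocalRing / ringKrullDim /
Ideal.map; LuAlphaPTorsor = stmt-0641 and PatchingRel = stmt-0642 verbatim)

Rationale: WHY THIS LINE. (widen: ramification theory of valued function fields, Abhyankar's school.)
CossartPiltant2008 (doi:10.1016/j.jalgebra.2008.03.032) Thm 7.2 reduces local uniformization (LU) in
dimension 3, over ARBITRARY ground fields of char p, to LU one step up an immediate degree-p
Artin-Schreier or purely inseparable covering of an already uniformized germ ("pulling up"; the hard
case, CossartPiltant2009), using only Krull's structure theory of inertia/ramification groups (Prop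
6.2, Cor 6.3), Perron transforms (Lemma 8.2, any dimension), non-immediate prime-degree ascent (Prop
8.3), tame push-down below the ramification field (Props 9.3-9.5) — and, silently, embedded
resolution / principalisation in REGULAR threefolds (Props 4.1, 4.2, via Cor 4.6 'weak => strong LU'
and Prop 8.1 'refined monomialization'). The rev<=4 typing (absolute LU ascends; LU_abs -> Res) hid
exactly that input: CutkoskyMourtada2019 §1 'all proofs of LU in dimension m >= 3 require ELU; we do
not know ELU in dimension 4'. The pivot makes ELU an explicit crux (EluRegular, new to the summit:
no other route files it), states every step RELATIVE (dominate a given f.g. R ⊆ O, the currency both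
Abhyankar's induction and Zariski patching consume), and SHARES the purely inseparable step
(LuAlphaPTorsor = stmt-0641) and patching (PatchingRel = stmt-0642) with route Valuative. What
remains distinctive: the Artin-Schreier step AsAscentRel (Kuhlmann2000 Open Problem 10,
dimension-free) and the GROUND-FIELD-ROBUST reduction AbhyankarReduction — Valuative's reduction
(TorsorToLurel, stmt-10968) instead transports Temkin2013's l-smooth models by Frobenius and meets
Literature.Barriers.ResolutionOfSingularities.InseparableBaseChange head-on for [k:k^p] = ∞;
Abhyankar's needs no Frobenius transport. Imported: valuation/ramification theory (Krull,
Abhyankar1959 Thm 4.9/Prop 4.10, Kuhlmann's defect), toric combinatorics (Perron; tame cyclic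
quotients, CP2008 Lemma 9.4); nothing from analysis.
RANKED CRUXES. #2 AsAscentRel — relative LU ascends along degree-p Galois extensions, given relative
LU + ELU downstairs (why it might fail: it is LU itself one wild step at a time: no terminating
invariant for X^p - g^{p-1}X + f over a regular local ring of dim >= 4, CossartPiltant2019 Rem 3.2
omega rises at n = 4; defect/immediate case = Kuhlmann2000 OP10; sources CossartPiltant2009,
arXiv:1412.0868, Kuhlmann2000, Abhyankar1959). #3 EluRegular — local
principalisation/monomialisation of ideals along a valuation in regular f.g. models, isomorphic off
V(f) (why it might fail: = ELU, open in dim >= 4 for every p, CutkoskyMourtada2019 §1; implied by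
embedded resolution/principalisation on regular varieties, NOT by the weak summit, so the route
could be strictly harder than the problem; known dim <= 3 via CossartPiltant2008 Props 4.1/4.2 +
CossartJannsenSaito2020, Abhyankar places KnafKuhlmann2005, char 0). #4 AbhyankarReduction —
AsAscentRel -> EluRegular -> (∀ p prime, LuAlphaPTorsor_p -> LUrel_p), for ALL ground fields k (why
it might fail: a step of CP2008 §§6-9 may use dimension 3 beyond Props 4.1/4.2/5.1 — candidates:
Prop 9.3's generators (47) of P' = (x_{r+1},..,x_3) and the case analysis of Prop 8.1; the induction
needs LUrel in lower trdeg over IMPERFECT residually-transcendental ground fields k(t), fine since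
all k are quantified; rank > 1 via NovacoskiSpivakovsky2014_holds). #5 LuAlphaPTorsor (stmt-0641,
shared; Valuative ranks it 2). #6 PatchingRel (stmt-0642, shared; Valuative ranks it 3; possibly
summit-hard: no LU => Res in dim >= 4 even in char 0, CutkoskyMourtada2019 p.3).
KILL CRITERIA. CLOSE (superseded by route Valuative) when Valuative's TorsorToLurel (stmt-10968:
LuAlphaPTorsor -> LUrel_p for ALL k) closes PROVED in tree: then the Artin-Schreier step is
certified logically redundant for the summit and this route's only residual content is EluRegular,
which Valuative should then attach. CLOSE (refuted) if AbhyankarReduction is refuted in a way that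
survives adding '(h : CossartPiltant2019) ->' and lower-dimensional LUrel hypotheses (i.e. the
skeleton genuinely needs global embedded resolution in dim n, not ELU along the valuation). DEMOTE
below Valuative if a refuter shows AsAscentRel's hypotheses (LUrel + ELU downstairs) already imply
its conclusion via 0641-type steps (AS reducible to PI along the valuation). A refutation of
EluRegular by an explicit regular 4-fold + valuation + ideal is a major event (¬ELU_4): file it as a
barrier, close this route refuted:EluRegular, and flag Valuative's 0641/0642 (which hide the same
input).
NOT DECOMPOSED YET. AsAscentRel: immediate (defect) vs non-immediate case (CP2008 Prop 8.3 is the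
non-immediate half and should split off as support once someone is seated);
rank-one/residually-algebraic reduction inside AbhyankarReduction (NovacoskiSpivakovsky2014_holds +
the k(t) trick of CP2008 Prop 5.1); EluRegular: dim A0 <= 3 from (h : CossartPiltant2019)-free CJS
input, Abhyankar valuations (KnafKuhlmann2005), rank one + Perron for monomial ideals, the char-free
'principalisation of (f,g)' sub-case used by Cor 4.6; the Lean bookkeeping 'LUrel + EluRegular =>
embedded LUrel' (one invocation, sandwich lemma isRegularLocalRing_localization_of_sandwich in
Literature/…/AffineModelLU). All layer-2, to be filed by glued split when #2, #3 or #4 moves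
(D-0019).
CHEAPEST FALSIFIER. A lookup: read CossartPiltant2008 Prop 9.3 (pp. 26-28) and Prop 8.1 (pp. 21-23)
with n in place of 3 and list every sentence that uses '3' other than through Props 4.1/4.2/4.6/5.1;
if one survives (e.g. the birationality argument giving (47)), AbhyankarReduction as typed is not
CP's theorem with 3 erased and must be split into an induction-on-trdeg statement. Second cheapest:
instantiate EluRegular with m = 1, I_1 = (x, y) ⊆ k[x,y,z,w], f = x and a rank-one valuation of
rational rank 4 (monomial valuation): the toric answer must satisfy the 'open immersion over D(f)'
clause — a refuter checks the clause is not accidentally unsatisfiable (it is satisfied by the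
blow-up charts, see tenure NOTES).
SUPPORT. The rev<=4 items are kept as dominated special cases: CycliccoversThesis (0564), Rellu
(0566), RelluToLu (0567), Patching (0561), LuasLocalModel (0568) all follow from LUrel_p ∧
PatchingRel_p (absolute LU is relative LU at R := ⊥; their conclusions are instances of LU_p) —
provable the day AbhyankarReduction's conclusion lands, not before; Assembly (0565, rev-1 frame) is
unprovable stand-alone and Assembly2 (1031) is proved; neither is the deciding theorem.
SOURCES. CossartPiltant2008 (read pp. 1-3, 7-8, 14-15, 17, 19-30 this session: Thm 7.2, Props
4.1/4.2, Cor 4.6, Prop 5.1, Cor 6.3, Props 8.1/8.3, Lemma 8.2, Props 9.3/9.5, Lemma 9.4);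
CossartPiltant2009; CossartPiltant2019 = arXiv:1412.0868 (Rem 3.2, via
Literature.Barriers.ResolutionOfSingularities.DimensionFourFrontier); CutkoskyMourtada2019 =
arXiv:1711.02726 §1 (ELU/LRM architecture, quoted in the same barrier file); Kuhlmann2000 =
arXiv:1003.5689 OP10; Abhyankar1956, Abhyankar1959; KnafKuhlmann2005; CossartJannsenSaito2020;
NovacoskiSpivakovsky2014 (Thm 1.1, proved in tree); Temkin2013 = arXiv:0804.1554 (the competing
reduction); Piltant2013; ZariskiSamuel1960 VI.17.

Novelty: NOVELTY (tenure g2 pivot 2026-08-15; search-before-claim: the 2026-08-14 retriage searches recorded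
below were re-used — lit search / searchd answered rc 75 throughout this session (19:13-19:20Z,
retried) — plus page reads this session of CossartPiltant2008 pp. 1-3, 7-8, 14-15, 17, 19-30 (held,
paper:doi-10-1016-j-jalgebra-2008-03-032) and of the tree:
Literature/AlgebraicGeometry/Resolution/{LocalUniformization, RankOneReduction, ResolutionLU,
GeneralLU, InseparableLocalUniformization}.lean,
Literature/Barriers/ResolutionOfSingularities/{DimensionFourFrontier,
LocalMonomializationFails}.lean, all six Theses files of the summit).
Nearest prior art — the line IS the Abhyankar–Cossart–Piltant ramification programme, now typed
faithfully:
- Abhyankar1959 (AM-43, doi:10.1515/9781400881390) Thm 4.9 / p.83 Prop 4.10 (prime-degree cyclic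
ascent of LU through splitting/inertia/ramification fields, trdeg 2); Abhyankar1956
(doi:10.2307/1970014), the char-p surface case.
- CossartPiltant2008 (doi:10.1016/j.jalgebra.2008.03.032) Thm 7.2 pp.19-21 = AbhyankarReduction with
'3'; its silent inputs Props 4.1/4.2 (embedded resolution / principalisation in regular threefolds,
p.7-8, 'Abhyankar–Hironaka–Zariski'), Cor 4.6 (weak => strong LU, p.14), Prop 8.1 (refined
monomialization, p.21) = EluRegular with '3'; CossartPiltant2009 + arXiv:1412.0868 Thm 1.4 =
AsAscentRel ∧ LuAlphaPTorsor with '3'.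
- CutkoskyMourtada2019 (arXiv:1711.02726) §1 Defs 1.1-1.3: the ELU/LRM/LU architecture ('ELU in
dimen  [refs: 10.1515/9781400881390, 10.2307/1970014, 10.1016/j.jalgebra.2008.03.032, 1412.0868, 1711.02726, 1003.5689, 2302.07710, 0804.1554, paper:doi-10-1016-j-jalgebra-2008-03-032, doi:10.1515/9781400881390, doi:10.2307/1970014, doi:10.1016/j.jalgebra.2008.03.032, CossartPiltant2008, Abhyankar1959, Abhyankar1956, CossartPiltant2009, CutkoskyMourtada2019, Kuhlmann2000, Cutkosky2025, KnafKuhlmann2005, KnafKuh]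

Barriers (technique_class: local-uniformization zariski-patching ramification-ascent): - technique_class: local-uniformization zariski-patching ramification-ascent
- Literature.Barriers.ResolutionOfSingularities.DimensionFourFrontier: NOT evaded — ISOLATED. The
catalogue's missing inputs are now items by name: ELU in regular n-folds = EluRegular (#3), LU_4's
wild step = AsAscentRel (#2) + LuAlphaPTorsor (0641), ZariskiPatchingUpToDim n = PatchingRel (0642);
CossartPiltant2019 Rem 3.2 (bind₁_cpRemark32Poly, omega rises to p+1 at n = 4) is an instance of
0641's live case and, with g ≠ 0, of AsAscentRel's. The bet is only that naming ELU separately lets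
valuation-theoretic partial results (Abhyankar places, rank one + Perron, dim A0 <= 3) accumulate on
it and that AbhyankarReduction is provable NOW from the three named inputs.
- Literature.Barriers.ResolutionOfSingularities.Cutkosky2014: EVADED BY STATEMENT for EluRegular —
Cutkosky2014 / LocalMonomializationFails (and Cutkosky2025) refute (weak) local MONOMIALIZATION OF
EXTENSIONS R → S of regular local rings along a valuation (defect 2, trdeg >= 2); EluRegular
monomialises IDEALS inside ONE regular local ring by birational modification (true in char 0 and in
dim <= 3 in every characteristic), and AsAscentRel asks for a regular model upstairs, not a monomial
form of O∩K-model → O-model. NOT evaded as a technique for AsAscentRel: a proof that monomialises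
the degree-p covering along the valuation is forbidden by these examples.
- Literature.Barriers.ResolutionOfSingularities.chevalley_barrier: NOT evaded — confron

Novelty grade: variant — ROUTE-REVIEW VERDICT g2 (refuter rreview1-CyclicCovers-g2, 2026-08-15, rev 8 = tenure-g2 pivot): KEEP OPEN; novelty VARIANT (as g1: Abhyankar1959 4.9/4.10 + CP2008 Thm 7.2/§§6-9 + CP2009 with '3' erased; the pivot names the hidden levers ELU + relative form, adds none). STATE: closes(hAS,hPI,hElu,hR (refuter refuter-rreview1-ResolutionOfSingularities-Cycl-5d4968c8-g2-0, 2026-08-15T20:10:52Z; prior: CossartPiltant2008 doi:10.1016/j.jalgebra.2008.03.032 Thm 7.2, Props 5.1/8.1/8.3/9.3/9.5, Lemma 9.4 (pp.16-30 read), CossartPiltant2009 doi:10.1016/j.jalgebra.2008.11.030 (AS/PI LU, trdeg 3), CossartPiltant2019 = arXiv:1412.0868 Thm 1.4, Rem 3.2, Abhyankar1959 doi:10.1515/9781400881390 Thm 4.9 / Prop 4.10, Abhyankar1956 doi:10.2307/1970014, Kuhlmann2000 = arXiv:1003.5689 Open Problem 10, CutkoskyM)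

History (route lifecycle, newest last):
- 2026-08-16T14:43:06Z · LINT AUTOFIX route.multi-assembly: kept Assembly, dropped Assembly2 (gate:hygiene)
- 2026-08-24T15:55:59Z · DORMANT — reconciler: no traction for 6.9 d (last activity item-evidence-added at 2026-08-17T18:22:14Z); parked, not closed — `ledger route dormant route-ResolutionOfSing (operator:999:2345181)
- 2026-08-26T21:01:28Z · REACTIVATED — reconciler: reactivated — activity item-evidence-added at 2026-08-26T20:04:10Z after parking at 2026-08-24T15:55:59Z (operator:999:1127435)

sub-problem: ResolutionOfSingularities · status: open · opened planner-ResolutionOfSingularities-Survey-0 2026-08-13T13:06:08Z · rev 10 · ledger route-ResolutionOfSingularities-CyclicCovers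
GENERATED by the gate from the ledger (D-0016/17). Provers cite these decls: `theorem foo : Summit.ResolutionOfSingularities.ResolutionOfSingularities.Theses.CyclicCovers.<Decl> := …` in Summits/ResolutionOfSingularities/ResolutionOfSingularities/Theorems/<Name>.lean.
-/

namespace Summit.ResolutionOfSingularities.ResolutionOfSingularities.Theses.CyclicCovers

open scoped BigOperators Topology Manifold Classical MeasureTheory ProbabilityTheory Matrix InnerProductSpace ComplexConjugate ContinuousMap
open Filter Set Function TopologicalSpace MeasureTheory

attribute [summit_statement] _root_.ResolutionOfSingularities

/-! Retired items kept as plain definitions (history; not obligations of this route): landed proofs / closed glue still name them. -/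

/-- retired stmt-ResolutionOfSingularities-1031 (dropped, gen None) — proved by Literature.AlgGeom.cyclicCovers_assembly_of_reduction. -/
def Assembly2 : Prop :=
  (∀ p : ℕ, p.Prime → (∀ (k K L : Type) [Field k] [CharP k p] [Field K] [Field L] [Algebra k K] [Algebra K L] [Algebra k L] [IsScalarTower k K L], (⊤ : IntermediateField k K).FG → Module.finrank K L = p → (IsGalois K L ∨ IsPurelyInseparable K L) → ∀ O : ValuationSubring L, (∀ c : k, algebraMap k L c ∈ O) → (∃ (A : Subalgebra k K) (h : A.toSubring ≤ (O.comap (algebraMap K L)).toSubring), A.FG ∧ IsFractionRing A K ∧ IsRegularLocalRing (Localization.AtPrime (Ideal.comap (Subring.inclusion h) (IsLocalRing.maximalIdeal (O.comap (algebraMap K L)))))) → ∃ (A : Subalgebra k L) (h : A.toSubring ≤ O.toSubring), A.FG ∧ IsFractionRing A L ∧ IsRegularLocalRing (Localization.AtPrime (Ideal.comap (Subring.inclusion h) (IsLocalRing.maximalIdeal O)))) → ∀ (k K : Type) [Field k] [CharP k p] [Field K] [Algebra k K], (⊤ : IntermediateField k K).FG → ∀ O : ValuationSubring K, (∀ c :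 k, algebraMap k K c ∈ O) → ∃ (A : Subalgebra k K) (h : A.toSubring ≤ O.toSubring), A.FG ∧ IsFractionRing A K ∧ IsRegularLocalRing (Localization.AtPrime (Ideal.comap (Subring.inclusion h) (IsLocalRing.maximalIdeal O)))) → (∀ p : ℕ, p.Prime → (∀ (k K L : Type) [Field k] [CharP k p] [Field K] [Field L] [Algebra k K] [Algebra K L] [Algebra k L] [IsScalarTower k K L], (⊤ : IntermediateField k K).FG → Module.finrank K L = p → (IsGalois K L ∨ IsPurelyInseparable K L) → ∀ O : ValuationSubring L, (∀ c : k, algebraMap k L c ∈ O) → (∃ (A : Subalgebra k K) (h : A.toSubring ≤ (O.comap (algebraMap K L)).toSubring), A.FG ∧ IsFractionRing A K ∧ IsRegularLocalRing (Localization.AtPrime (Ideal.comap (Subring.inclusion h) (IsLocalRing.maximalIdeal (O.comap (algebraMap K L)))))) → ∃ (A : Subalgebra k L) (h : A.toSubring ≤ O.toSubring), A.FG ∧ IsFractionRing A L ∧ IsRegularLocalRing (Localization.AtPrime (Ideal.comap (Subring.inclusion h) (IsLocalRing.maximalIdeal O)))) ∧ ((∀ (k K : Type) [Field k] [CharP k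 p] [Field K] [Algebra k K], (⊤ : IntermediateField k K).FG → ∀ O : ValuationSubring K, (∀ c : k, algebraMap k K c ∈ O) → ∃ (A : Subalgebra k K) (h : A.toSubring ≤ O.toSubring), A.FG ∧ IsFractionRing A K ∧ IsRegularLocalRing (Localization.AtPrime (Ideal.comap (Subring.inclusion h) (IsLocalRing.maximalIdeal O)))) → Literature.AlgebraicGeometry.Resolution.ResolutionInChar.{0} p)) → _root_.ResolutionOfSingularities

/-- item stmt-ResolutionOfSingularities-13611 · crux · rank 2 · open · by planner
why it might fail: It is LU one wild step at a time: no terminating invariant for X^p-g^{p-1}X+f over a regular local ring of dim>=4 (CossartPiltant2019 Rem 3.2: omega rises at n=4); immediate/defect AS steps = Kuhlmann2000 Open Problem 10; non-immediate half may hide more ELU than granted.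
sources: CossartPiltant2008 Thm 7.2, Prop 8.3 (doi:10.1016/j.jalgebra.2008.03.032, pp.19-25 read 2026-08-15), CossartPiltant2009, arXiv:1412.0868 Thm 1.4 / Rem 3.2 (CossartPiltant2019), Kuhlmann2000 = arXiv:1003.5689 p.42 Open Problem 10, Abhyankar1959 Prop 4.10, Literature.Barriers.ResolutionOfSingularities.DimensionFourFrontier
[crux] Relative local uniformization ASCENDS along degree-p Galois (Artin–Schreier) extensions: k of
char p, K/k finitely generated, L/K Galois of degree p, O a valuation ring of L over k, OK = O ∩ K;
IF every f.g. k-subalgebra of OK is dominated by a f.g. one with Frac = K regular at the centre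
(LUrel downstairs, stmt-0642's antecedent shape) AND regular f.g. models of OK admit local
principalisation/monomialisation of nonzero ideals along OK, isomorphically off V(f) (EluRegular's
shape downstairs), THEN every f.g. k-subalgebra R ⊆ O is dominated by a f.g. A ⊆ O with Frac A = L
regular at the centre m_O ∩ A. = the Artin–Schreier half of CossartPiltant2008 Thm 7.2's hypothesis
(immediate case) plus Prop 8.3 (non-immediate case), with '3' erased and stated relative;
CossartPiltant2009 prove it for trdeg 3. Supersedes the AS half of Rellu (stmt-0566, absolute).
[deps: none] [difficulty: open problem in trdeg >= 4 (Kuhlmann2000 OP10)] — why it might fail: It is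
LU one wild step at a time: no terminating invariant for X^p-g^{p-1}X+f over a regular local ring of
dim>=4 (CossartPiltant2019 Rem 3.2: omega rises at n=4); immediate/defect AS steps = Kuhlmann2000
Open Problem 10; non-immedia -/
@[route_item "route-ResolutionOfSingularities-CyclicCovers", crux]
def AsAscentRel : Prop :=
  ∀ p : ℕ, p.Prime → ∀ (k K L : Type) [Field k] [CharP k p] [Field K] [Field L] [Algebra k K] [Algebra K L] [Algebra k L] [IsScalarTower k K L], (⊤ : IntermediateField k K).FG → Module.finrank K L = p → IsGalois K L → ∀ (O : ValuationSubring L) (OK : ValuationSubring K), OK = O.comap (algebraMap K L) → (∀ c : k, algebraMap k L c ∈ O) → (∀ R : Subalgebra k K, R.FG → R.toSubring ≤ OK.toSubring → ∃ (A : Subalgebra k K) (h : A.toSubring ≤ OK.toSubring), R ≤ A ∧ A.FG ∧ IsFractionRing A K ∧ IsRegularLocalRing (Localization.AtPrime (Ideal.comap (Subring.inclusion h) (IsLocalRing.maximalIdeal OK)))) → (∀ (A₀ : Subalgebra k K) (h₀ : A₀.toSubring ≤ OK.toSubring), A₀.FG → IsFractionRing A₀ K → IsRegularLocalRing (Localization.AtPrime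 (Ideal.comap (Subring.inclusion h₀) (IsLocalRing.maximalIdeal OK))) → ∀ (m : ℕ) (I : Fin m → Ideal A₀.toSubring) (f : K) (hf : f ∈ A₀.toSubring), (∀ j, I j ≠ ⊥) → (∀ j, ∃ n : ℕ, (⟨f, hf⟩ : A₀.toSubring) ^ n ∈ I j) → ∃ (A : Subalgebra k K) (h : A.toSubring ≤ OK.toSubring) (h₀A : A₀.toSubring ≤ A.toSubring), A.FG ∧ IsFractionRing A K ∧ IsRegularLocalRing (Localization.AtPrime (Ideal.comap (Subring.inclusion h) (IsLocalRing.maximalIdeal OK))) ∧ (∀ Q : Ideal A.toSubring, Q.IsPrime → Subring.inclusion h₀A ⟨f, hf⟩ ∉ Q → ∀ a ∈ A, ∃ (s : K) (hs : s ∈ A₀.toSubring), Subring.inclusion h₀A ⟨s, hs⟩ ∉ Q ∧ s * a ∈ A₀) ∧ ∃ (d : ℕ) (u : Fin d → Localization.AtPrime (Ideal.comap (Subring.inclusion h) (IsLocalRing.maximalIdeal OK))), Ideal.span (Set.range u) = IsLocalRing.maximalIdeal (Localization.AtPrime (Ideal.comap (Subring.inclusion h) (IsLocalRing.maximalIdeal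 OK))) ∧ ringKrullDim (Localization.AtPrime (Ideal.comap (Subring.inclusion h) (IsLocalRing.maximalIdeal OK))) = (d : WithBot ℕ∞) ∧ ∀ j, ∃ e : Fin d → ℕ, (I j).map ((algebraMap A.toSubring (Localization.AtPrime (Ideal.comap (Subring.inclusion h) (IsLocalRing.maximalIdeal OK)))).comp (Subring.inclusion h₀A)) = Ideal.span {Finset.univ.prod fun i => u i ^ e i}) → ∀ R : Subalgebra k L, R.FG → R.toSubring ≤ O.toSubring → ∃ (A : Subalgebra k L) (h : A.toSubring ≤ O.toSubring), R ≤ A ∧ A.FG ∧ IsFractionRing A L ∧ IsRegularLocalRing (Localization.AtPrime (Ideal.comap (Subring.inclusion h) (IsLocalRing.maximalIdeal O)))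

/-- item stmt-ResolutionOfSingularities-13621 · crux · rank 3 · open · by planner
why it might fail: = ELU, open in dim >= 4 for every p (CutkoskyMourtada2019 §1 'we do not know ELU in dimension 4'); implied by embedded resolution on regular varieties but NOT by the weak summit, so it may be strictly harder than the problem; small-p directrix failure (hironakaQuadric).
sources: CutkoskyMourtada2019 = arXiv:1711.02726 §1 Defs 1.1-1.3, CossartPiltant2008 Props 4.1, 4.2, Cor 4.6, Prop 8.1 (doi:10.1016/j.jalgebra.2008.03.032 pp.7-8, 14, 21-23 read 2026-08-15), CossartJannsenSaito2020, KnafKuhlmann2005, Literature.Barriers.ResolutionOfSingularities.DimensionFourFrontier, Literature.Barriers.ResolutionOfSingularities.hironakaQuadric_directrixZero_and_nearPoint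
[crux] Embedded local uniformization / local principalisation along a valuation in REGULAR models
(ELU), char p, all dimensions: k of char p, O a valuation ring of K over k, A₀ ⊆ O a f.g.
k-subalgebra with Frac A₀ = K whose localisation at the centre is regular, nonzero ideals I_1..I_m
of A₀ and f ∈ A₀ with a power of f in each I_j (f = 0 allowed: no control requested). CLAIM: there
is a f.g. A with A₀ ⊆ A ⊆ O, Frac A = K, A regular at the centre, such that Spec A → Spec A₀ is an
open immersion over D(f) (for every prime Q of A not containing f, A ⊆ (A₀)_{Q∩A₀}), and a regular
system of parameters u_1..u_d of A at the centre (span = maximal ideal, d = Krull dim) in which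
every I_j·A_centre is the principal ideal generated by a MONOMIAL in u. = CossartPiltant2008 Props
4.1 (embedded resolution) + 4.2 (principalisation) + Cor 4.6 + Prop 8.1 localised at the centre of
the valuation, with '3' erased; = CutkoskyMourtada2019 Def 1.2 'ELU in dimension m' for ideals.
Known: char 0 all dims (Hironaka/Zariski), dim A₀ <= 3 every char (CP2008 §4 via
Cossart–Jannsen–Saito), Abhyankar places (KnafKuhlmann2005). OPEN dim >= 4, char p. Implied by
embedded resolution + principalisation on regular -/
@[route_item "route-ResolutionOfSingularities-CyclicCovers", crux]
def EluRegular : Prop :=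
  ∀ p : ℕ, p.Prime → ∀ (k K : Type) [Field k] [CharP k p] [Field K] [Algebra k K] (O : ValuationSubring K), ∀ (A₀ : Subalgebra k K) (h₀ : A₀.toSubring ≤ O.toSubring), A₀.FG → IsFractionRing A₀ K → IsRegularLocalRing (Localization.AtPrime (Ideal.comap (Subring.inclusion h₀) (IsLocalRing.maximalIdeal O))) → ∀ (m : ℕ) (I : Fin m → Ideal A₀.toSubring) (f : K) (hf : f ∈ A₀.toSubring), (∀ j, I j ≠ ⊥) → (∀ j, ∃ n : ℕ, (⟨f, hf⟩ : A₀.toSubring) ^ n ∈ I j) → ∃ (A : Subalgebra k K) (h : A.toSubring ≤ O.toSubring) (h₀A : A₀.toSubring ≤ A.toSubring), A.FG ∧ IsFractionRing A K ∧ IsRegularLocalRing (Localization.AtPrime (Ideal.comap (Subring.inclusion h) (IsLocalRing.maximalIdeal O))) ∧ (∀ Q : Ideal A.toSubring, Q.IsPrime → Subring.inclusion h₀A ⟨f, hf⟩ ∉ Q → ∀ a ∈ A, ∃ (s : K) (hs : s ∈ A₀.toSubring), Subring.inclusion h₀A ⟨s, hs⟩ ∉ Q ∧ s * a ∈ A₀)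 ∧ ∃ (d : ℕ) (u : Fin d → Localization.AtPrime (Ideal.comap (Subring.inclusion h) (IsLocalRing.maximalIdeal O))), Ideal.span (Set.range u) = IsLocalRing.maximalIdeal (Localization.AtPrime (Ideal.comap (Subring.inclusion h) (IsLocalRing.maximalIdeal O))) ∧ ringKrullDim (Localization.AtPrime (Ideal.comap (Subring.inclusion h) (IsLocalRing.maximalIdeal O))) = (d : WithBot ℕ∞) ∧ ∀ j, ∃ e : Fin d → ℕ, (I j).map ((algebraMap A.toSubring (Localization.AtPrime (Ideal.comap (Subring.inclusion h) (IsLocalRing.maximalIdeal O)))).comp (Subring.inclusion h₀A)) = Ideal.span {Finset.univ.prod fun i => u i ^ e i}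

/-- item stmt-ResolutionOfSingularities-13707 · crux · rank 4 · open · by planner
why it might fail: A step of CP2008 §§6-9 may use dim 3 beyond Props 4.1/4.2/5.1: Prop 9.3's generators (47) of P'=(x_{r+1},..,x_3) via birationality of Spec S'/P' → Spec R₁'/P₁', or Prop 8.1's ♯E bookkeeping; ELU 'along O' may be weaker than the GLOBAL Props 4.1/4.2 CP invoke on a quasi-projective regular model.
sources: CossartPiltant2008 Thm 7.2 + Props 5.1, 6.2, 8.1, 8.3, 9.3, 9.5, Lemmas 6.1, 8.2, 9.4 (doi:10.1016/j.jalgebra.2008.03.032, pp.17-30 read 2026-08-15), Abhyankar1959 Thm 4.9, NovacoskiSpivakovsky2014 = arXiv:1204.4751 Thm 1.1 (Literature.AlgebraicGeometry.Resolution.NovacoskiSpivakovsky2014, proved in tree), Temkin2013 = arXiv:0804.1554 Rem 1.3.5 (competing reduction, route Valuative stmt-10968), Literature.Barriers.ResolutionOfSingularities.InseparableBaseChange, Literature.Barriers.ResolutionOfSingularities.DimensionFourFrontier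
[crux] Abhyankar's ramification-theoretic reduction, dimension-free and for EVERY ground field of
char p: AsAscentRel → EluRegular → ∀ p prime, LuAlphaPTorsor_p (stmt-0641's body at p) → LUrel_p
(the two new sibling decls are referenced BY NAME to stay under the 4000-char signature cap; they
precede this decl in the file by rank) (relative local uniformization for all f.g. K/k, all
valuation rings O ⊇ k, all f.g. R ⊆ O; verbatim the antecedent of PatchingRel = stmt-0642). On paper
= CossartPiltant2008 Thm 7.2 with '3' erased: induct on trdeg; rank > 1 by
NovacoskiSpivakovsky2014_holds (in tree), residually transcendental O by enlarging k to k(t) ⊆ O;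
transcendence basis x with O x_i >= 0 and base case LUrel of k(x) from EluRegular on k[x]
(principalise (f_i, g_i) along O, sandwich); separable closure K₁ of k(x) in K and the purely
inseparable tower K₁ ⊂ … ⊂ K by 0641 + normality; Galois closure L/k(x), Krull
splitting/inertia/ramification fields (CP2008 Prop 6.2, Lemma 6.1), etale ascent to the inertia
field (Cor 6.3), tame abelian prime-to-p ascent (Prop 8.3(2) from Prop 8.1 = EluRegular + Perron
Lemma 8.2), p-group composition series making K^r/K₀^r a tower of degree-p Galois ste -/
@[route_item "route-ResolutionOfSingularities-CyclicCovers", crux]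
def AbhyankarReduction : Prop :=
  AsAscentRel → EluRegular → ∀ p : ℕ, p.Prime → (∀ (k K : Type) [Field k] [CharP k p] [Field K] [Algebra k K] (O : ValuationSubring K) (A₀ : Subalgebra k K) (h₀ : A₀.toSubring ≤ O.toSubring) (t : K), A₀.FG → t ^ p ∈ A₀ → IsFractionRing (Algebra.adjoin k (insert t (A₀ : Set K))) K → IsRegularLocalRing (Localization.AtPrime (Ideal.comap (Subring.inclusion h₀) (IsLocalRing.maximalIdeal O))) → ∃ (A : Subalgebra k K) (h : A.toSubring ≤ O.toSubring), A₀ ≤ A ∧ t ∈ A ∧ A.FG ∧ IsFractionRing A K ∧ IsRegularLocalRing (Localization.AtPrime (Ideal.comap (Subring.inclusion h) (IsLocalRing.maximalIdeal O)))) → (∀ (k K : Type) [Field k] [CharP k p] [Field K] [Algebra k K], (⊤ : IntermediateField k K).FG → ∀ O : ValuationSubring K, (∀ c : k, algebraMap k K c ∈ O) → ∀ R : Subalgebra k K, R.FG → R.toSubring ≤ O.toSubring → ∃ (A : Subalgebra k K) (h : A.toSubring ≤ O.toSubring), R ≤ A ∧ A.FG ∧ IsFractionRing A K ∧ IsRegularLocalRing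 (Localization.AtPrime (Ideal.comap (Subring.inclusion h) (IsLocalRing.maximalIdeal O))))

/-- item stmt-ResolutionOfSingularities-0641 · crux · rank 5 · open · by planner
why it might fail: Live case t∉Frac A₀ = LU of t^p=a over a regular (n+1)-fold along O: OPEN n≥4, all p (Temkin2013 Rem 1.3.5 'all bad things happen'; CutkoskyMourtada2019: ELU unknown in dim 4; CossartPiltant2019 Rem 3.2); one regular A₀ given, no ELU downstairs granted.
sources: Temkin2013 = arXiv:0804.1554 Rem 1.3.5(ii)-(iii), CutkoskyMourtada2019 = arXiv:1711.02726 §1, CossartPiltant2008 eq.(1) + CossartPiltant2009 (dim 3, g = 0), Literature.Barriers.ResolutionOfSingularities.DimensionFourFrontier, route Valuative stmt-ResolutionOfSingularities-0641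
THE CRUX (supersedes stmt-0560 LUPI). Relative local uniformization of α_p-TORSORS over a regular
base (Temkin2013 = arXiv:0804.1554 Rem 1.3.5(ii)-(iii), 'if we know how to uniformize valuations on
α_p-torsors over regular schemes…'): k of char p, O a valuation ring of K, A₀ ⊆ O a finitely
generated k-subalgebra REGULAR AT THE CENTRE m_O ∩ A₀, t ∈ K with t^p ∈ A₀ and Frac(A₀[t]) = K (so
[K : Frac A₀] ∈ {1, p}, purely inseparable). CLAIM: there is a finitely generated k-subalgebra A
with A₀[t] ⊆ A ⊆ O, Frac A = K, A regular at the centre. Degenerate case t ∈ Frac A₀ is true via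
'regular local ⇒ normal' (A := A₀[t] localises to (A₀)_centre). Live case = Zariski hypersurface t^p
= a over a regular local ring of dim n; known n ≤ 3 (CossartPiltant2008/2009 inseparable case g =
0), OPEN n ≥ 4. ¬(this) is morally ¬LU_p, a problem decider rather than a route killer. -/
@[route_item "route-ResolutionOfSingularities-CyclicCovers", crux]
def LuAlphaPTorsor : Prop :=
  ∀ p : ℕ, p.Prime → ∀ (k K : Type) [Field k] [CharP k p] [Field K] [Algebra k K] (O : ValuationSubring K) (A₀ : Subalgebra k K) (h₀ : A₀.toSubring ≤ O.toSubring) (t : K), A₀.FG → t ^ p ∈ A₀ → IsFractionRing (Algebra.adjoin k (insert t (A₀ : Set K))) K → IsRegularLocalRing (Localization.AtPrime (Ideal.comap (Subring.inclusion h₀) (IsLocalRing.maximalIdeal O))) → ∃ (A : Subalgebra k K) (h : A.toSubring ≤ O.toSubring), A₀ ≤ A ∧ t ∈ A ∧ A.FG ∧ IsFractionRing A K ∧ IsRegularLocalRing (Localization.AtPrime (Ideal.comap (Subring.inclusion h) (IsLocalRing.maximalIdeal O)))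

/-- item stmt-ResolutionOfSingularities-0642 · crux · rank 6 · open · by planner
why it might fail: Gluing LUs into ONE proper regular model is known only in dim<=3 (Zariski; CP2008 Prop 4.9/Piltant2013 use surface factorisation + embedded resolution in regular 3-folds); in dim>=4 no Res<=LU even in char 0 (CutkoskyMourtada2019 p.3); plain LUrel may be weaker than the embedded LU patching needs.
sources: CutkoskyMourtada2019 = arXiv:1711.02726 §1 p.3, CossartPiltant2008 Prop 4.9 (doi:10.1016/j.jalgebra.2008.03.032 pp.15-16), Piltant2013 (doi:10.1007/s13398-012-0090-6), NovacoskiSpivakovsky2016 §1, Literature.Barriers.ResolutionOfSingularities.DimensionFourFrontier, route Valuative stmt-ResolutionOfSingularities-0642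
PatchingRel_p (supersedes stmt-0561 for this route): RELATIVE local uniformization LUrel_p (all f.g.
K/k with char k = p, all valuation rings O ⊇ k, all f.g. R ⊆ O dominated) implies ResolutionInChar
p. Zariski's patching: fix a projective model X, LUrel gives for each O ∈ RZ(X) a regular model
dominating X near the centre, quasi-compactness of RZ(X) gives finitely many, then DOMINATE/glue
them into one proper regular model of X — known dim 2 (Zariski 1939), dim 3 (Zariski 1944 char 0;
CossartPiltant2008/2009 + Piltant2013 axiomatics in char p), OPEN as an implication in dim ≥ 4 (the
glueing step uses resolution/principalization in dimension n−1). Refuters: say whether weak-EMBEDDED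
LUrel (finite Z ⊆ R made monomial in a regular system of parameters, NovacoskiSpivakovsky2014 Thm
1.2/1.3) is what Piltant2013's axioms actually consume; if so the planner supersedes with the
embedded antecedent. Lean-side: needs centre of a valuation on a proper k-scheme, RZ space, blow-ups
— none in Mathlib; with (h : CossartPiltant2019) the dim ≤ 3 sub-case is immediate and LU-free. -/
@[route_item "route-ResolutionOfSingularities-CyclicCovers", crux]
def PatchingRel : Prop :=
  ∀ p : ℕ, p.Prime → (∀ (k K : Type) [Field k] [CharP k p] [Field K] [Algebra k K], (⊤ : IntermediateField k K).FG → ∀ O : ValuationSubring K, (∀ c : k, algebraMap k K c ∈ O) → ∀ R : Subalgebra k K, R.FG → R.toSubring ≤ O.toSubring → ∃ (A : Subalgebra k K) (h : A.toSubring ≤ O.toSubring), R ≤ A ∧ A.FG ∧ IsFractionRing A K ∧ IsRegularLocalRing (Localization.AtPrime (Ideal.comap (Subring.inclusion h) (IsLocalRing.maximalIdeal O)))) → Literature.AlgebraicGeometry.Resolution.ResolutionInChar.{0} p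

/-- item stmt-ResolutionOfSingularities-0564 · support · rank 0 · open · by planner
why it might fail: X = RelLU_p ∧ Patching_p, both open in trdeg>=4 (arXiv:1412.0868 p.3). Patching takes ABSOLUTE weak LU: printed patching (CossartPiltant2008 Prop 4.9) needs principalisation Prop 4.2, trdeg 3 only; no direct LU=>Res proof in dim>=4 even in char 0 (CutkoskyMourtada2019 p.3).
sources: CossartPiltant2008, CutkoskyMourtada2019, arXiv:1412.0868, Temkin2013
For every prime p: RelLU_p (if L/K is a degree-p Galois or purely inseparable extension of finitely
generated fields over k, char k = p, O a valuation ring of L over k, and O ∩ K admits local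
uniformization over k, then O admits local uniformization over k) and Patching_p (LU_p ->
ResolutionInChar p). -/
@[route_item "route-ResolutionOfSingularities-CyclicCovers"]
def CycliccoversThesis : Prop :=
  ∀ p : ℕ, p.Prime → (∀ (k K L : Type) [Field k] [CharP k p] [Field K] [Field L] [Algebra k K] [Algebra K L] [Algebra k L] [IsScalarTower k K L], (⊤ : IntermediateField k K).FG → Module.finrank K L = p → (IsGalois K L ∨ IsPurelyInseparable K L) → ∀ O : ValuationSubring L, (∀ c : k, algebraMap k L c ∈ O) → (∃ (A : Subalgebra k K) (h : A.toSubring ≤ (O.comap (algebraMap K L)).toSubring), A.FG ∧ IsFractionRing A K ∧ IsRegularLocalRing (Localization.AtPrime (Ideal.comap (Subring.inclusion h) (IsLocalRing.maximalIdeal (O.comap (algebraMap K L)))))) → ∃ (A : Subalgebra k L) (h : A.toSubring ≤ O.toSubring), A.FG ∧ IsFractionRing A L ∧ IsRegularLocalRing (Localization.AtPrime (Ideal.comap (Subring.inclusion h) (IsLocalRing.maximalIdeal O)))) ∧ ((∀ (k K : Type) [Field k] [CharP k p] [Field K] [Algebra k K], (⊤ : IntermediateField k K).FG → ∀ O : ValuationSubring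 K, (∀ c : k, algebraMap k K c ∈ O) → ∃ (A : Subalgebra k K) (h : A.toSubring ≤ O.toSubring), A.FG ∧ IsFractionRing A K ∧ IsRegularLocalRing (Localization.AtPrime (Ideal.comap (Subring.inclusion h) (IsLocalRing.maximalIdeal O)))) → Literature.AlgebraicGeometry.Resolution.ResolutionInChar.{0} p)

/-- item stmt-ResolutionOfSingularities-0566 · support · rank 2 · open · by planner
why it might fail: Trdeg>=4: no terminating invariant known for the multiplicity-p AS/PI hypersurface X^p-g^{p-1}X+f over a regular local ring of dim>=4 (CossartPiltant2019 Rem 3.2: omega rises at n=4); defect AS steps = Kuhlmann2000 Open Problem 10; weak LU of O∩K may be too weak even in trdeg 3 (CP2008 Cor 4.6).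
sources: CossartPiltant2008, CossartPiltant2009, CossartPiltant2019, Kuhlmann2000, arXiv:1412.0868, Abhyankar1959
RelLU_p: local uniformization ascends along degree-p Artin-Schreier (Galois) and degree-p purely
inseparable extensions L/K of finitely generated fields over k of char p: LU of O ∩ K implies LU of
O for every valuation ring O of L over k. Dimension-free form of the target of CossartPiltant2008's
reduction (proved in dim 3 by CossartPiltant2009); open in dim >= 4. -/
@[route_item "route-ResolutionOfSingularities-CyclicCovers"]
def Rellu : Prop :=
  ∀ p : ℕ, p.Prime → ∀ (k K L : Type) [Field k] [CharP k p] [Field K] [Field L] [Algebra k K] [Algebra K L] [Algebra k L] [IsScalarTower k K L], (⊤ : IntermediateField k K).FG → Module.finrank K L = p → (IsGalois K L ∨ IsPurelyInseparable K L) → ∀ O : ValuationSubring L, (∀ c : k, algebraMap k L c ∈ O) → (∃ (A : Subalgebra k K) (h : A.toSubring ≤ (O.comap (algebraMap K L)).toSubring), A.FG ∧ IsFractionRing A K ∧ IsRegularLocalRing (Localization.AtPrime (Ideal.comap (Subring.inclusion h) (IsLocalRing.maximalIdeal (O.comap (algebraMap K L)))))) → ∃ (A : Subalgebra k L) (h :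 A.toSubring ≤ O.toSubring), A.FG ∧ IsFractionRing A L ∧ IsRegularLocalRing (Localization.AtPrime (Ideal.comap (Subring.inclusion h) (IsLocalRing.maximalIdeal O)))

/-- item stmt-ResolutionOfSingularities-0567 · support · rank 3 · open · by planner
why it might fail: [k:k^p]<∞: PI half alone gives LU_p (Temkin2013 Rem 1.3.5(ii)+Thm 1.3.2). [k:k^p]=∞: no finite Frobenius tower; regularity unstable under inseparable ground-field change (InseparableBaseChange); CP2008 Thm 7.2's tame descent uses ELU/principalisation in regular n-folds (Props 4.1/4.2/5.1, trdeg 3).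
sources: Temkin2013, CossartPiltant2008, CutkoskyMourtada2019, Literature.Barriers.ResolutionOfSingularities.InseparableBaseChange, Literature.Barriers.ResolutionOfSingularities.DimensionFourFrontier
RelLU_p -> LU_p: the Cossart-Piltant reduction in all dimensions. From a p-alteration with regular
source (Temkin2017 Thm 1.2.5) and Abhyankar's tame descent, every valuation of K/k is reached from a
uniformized one by a tower of degree-p Galois or purely inseparable steps plus steps along which LU
descends for free. CossartPiltant2008 do dim 3; the grounder should report which step (if any) uses
dim 3 / lower-dimensional embedded resolution. -/
@[route_item "route-ResolutionOfSingularities-CyclicCovers"]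
def RelluToLu : Prop :=
  ∀ p : ℕ, p.Prime → (∀ (k K L : Type) [Field k] [CharP k p] [Field K] [Field L] [Algebra k K] [Algebra K L] [Algebra k L] [IsScalarTower k K L], (⊤ : IntermediateField k K).FG → Module.finrank K L = p → (IsGalois K L ∨ IsPurelyInseparable K L) → ∀ O : ValuationSubring L, (∀ c : k, algebraMap k L c ∈ O) → (∃ (A : Subalgebra k K) (h : A.toSubring ≤ (O.comap (algebraMap K L)).toSubring), A.FG ∧ IsFractionRing A K ∧ IsRegularLocalRing (Localization.AtPrime (Ideal.comap (Subring.inclusion h) (IsLocalRing.maximalIdeal (O.comap (algebraMap K L)))))) → ∃ (A : Subalgebra k L) (h : A.toSubring ≤ O.toSubring), A.FG ∧ IsFractionRing A L ∧ IsRegularLocalRing (Localization.AtPrime (Ideal.comap (Subring.inclusion h) (IsLocalRing.maximalIdeal O)))) → ∀ (k K : Type) [Field k] [CharP k p] [Field K] [Algebra k K], (⊤ : IntermediateField k K).FG → ∀ O : ValuationSubring K, (∀ c : k, algebraMap k K c ∈ O) → ∃ (A : Subalgebra k K) (h : A.toSubring ≤ O.toSubring), A.FG ∧ IsFractionRing A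 K ∧ IsRegularLocalRing (Localization.AtPrime (Ideal.comap (Subring.inclusion h) (IsLocalRing.maximalIdeal O)))

/-- item stmt-ResolutionOfSingularities-0561 · support · rank 4 · open · by planner
why it might fail: Open as implication in dim>=4: resolution deduced from LU only for threefolds (Temkin2013 p.3); no direct patching proof in dim>=4 even in char 0 (CutkoskyMourtada2019 p.3). Absolute weak LU: no model dominating X; gluing needs principalisation on regular n-folds (CP2008 Prop 4.9 via 4.2, trdeg 3).
sources: CossartPiltant2008, CutkoskyMourtada2019, Temkin2013, NovacoskiSpivakovsky2016, Piltant2013, Literature.Barriers.ResolutionOfSingularities.ZariskiPatchingUpToDim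
Patching_p: local uniformization in char p (LU_p, all finitely generated K/k and all valuation
rings) implies ResolutionInChar p. Zariski's patching is known in dim <= 3 (Zariski; Piltant2013
axiomatic version used by CossartPiltant2008); open as an implication in dim >= 4. A refuter should
check whether the non-embedded LU stated here is too weak for any patching argument
(embedded/simultaneous LU may be needed). -/
@[route_item "route-ResolutionOfSingularities-CyclicCovers"]
def Patching : Prop :=
  ∀ p : ℕ, p.Prime → (∀ (k K : Type) [Field k] [CharP k p] [Field K] [Algebra k K], (⊤ : IntermediateField k K).FG → ∀ O : ValuationSubring K, (∀ c : k, algebraMap k K c ∈ O) → ∃ (A : Subalgebra k K) (h : A.toSubring ≤ O.toSubring), A.FG ∧ IsFractionRing A K ∧ IsRegularLocalRing (Localization.AtPrime (Ideal.comap (Subring.inclusion h) (IsLocalRing.maximalIdeal O)))) → Literature.AlgebraicGeometry.Resolution.ResolutionInChar.{0} p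

/-- item stmt-ResolutionOfSingularities-0568 · support · rank 5 · open · by planner
why it might fail: b=0 slice = Valuative's Lupi (t^p=a over k[x]), open n≥4, incl. CP2019 Rem 3.2's Z^p+u4·u1^p+u3·u2^p (cpRemark32Poly); b≠0 slice = degree-p Artin–Schreier covers of A^n along defect valuations, open n≥4 (Kuhlmann2000 Open Problem 10; CP2009: trdeg 3). NB z∈k(x) (a=b=0) is trivial: A=k[x^±1]⊆O.
sources: CossartPiltant2009, CossartPiltant2019, Kuhlmann2000, arXiv:1412.0868, Temkin2013, Literature.Barriers.ResolutionOfSingularities.cpRemark32Poly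
LUAS_p: local uniformization for Artin-Schreier hypersurface function fields K = k(x_1..x_n, z), x
algebraically independent, z^p - b^{p-1} z = a with a, b in k[x]: every valuation ring O ⊇ k of K is
uniformized by a finitely generated k-subalgebra with regular localisation. AS companion of LUPI
(V2); Cossart-Piltant's Artin-Schreier case with polynomial base. -/
@[route_item "route-ResolutionOfSingularities-CyclicCovers"]
def LuasLocalModel : Prop :=
  ∀ p : ℕ, p.Prime → ∀ (k K : Type) [Field k] [CharP k p] [Field K] [Algebra k K] (n : ℕ) (x : Fin n → K) (z : K), AlgebraicIndependent k x → (∃ a ∈ Algebra.adjoin k (Set.range x), ∃ b ∈ Algebra.adjoin k (Set.range x), z ^ p - b ^ (p - 1) * z = a) → IntermediateField.adjoin k (insert z (Set.range x)) = ⊤ → ∀ O : ValuationSubring K, (∀ c : k, algebraMap k K c ∈ O) → ∃ (A : Subalgebra k K) (h : A.toSubring ≤ O.toSubring), A.FG ∧ IsFractionRing A K ∧ IsRegularLocalRing (Localization.AtPrime (Ideal.comap (Subring.inclusion h) (IsLocalRing.maximalIdeal O)))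

/-- item stmt-ResolutionOfSingularities-0565 · assembly · rank 1 · open · by planner
RelLU_p ∧ Patching_p for all p implies the summit: RelLU_p gives LU_p by the dimension-free
Cossart-Piltant reduction (crux C3: p-alteration Temkin2017 1.2.5 + tame descent + degree-p
filtration), then Patching. -/
@[route_item "route-ResolutionOfSingularities-CyclicCovers"]
def Assembly : Prop :=
  (∀ p : ℕ, p.Prime → (∀ (k K L : Type) [Field k] [CharP k p] [Field K] [Field L] [Algebra k K] [Algebra K L] [Algebra k L] [IsScalarTower k K L], (⊤ : IntermediateField k K).FG → Module.finrank K L = p → (IsGalois K L ∨ IsPurelyInseparable K L) → ∀ O : ValuationSubring L, (∀ c : k, algebraMap k L c ∈ O) → (∃ (A : Subalgebra k K) (h : A.toSubring ≤ (O.comap (algebraMap K L)).toSubring), A.FG ∧ IsFractionRing A K ∧ IsRegularLocalRing (Localization.AtPrime (Ideal.comap (Subring.inclusion h) (IsLocalRing.maximalIdeal (O.comap (algebraMap K L)))))) → ∃ (A : Subalgebra k L) (h : A.toSubring ≤ O.toSubring), A.FG ∧ IsFractionRing A L ∧ IsRegularLocalRing (Localization.AtPrime (Ideal.comap (Subring.inclusion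 h) (IsLocalRing.maximalIdeal O)))) ∧ ((∀ (k K : Type) [Field k] [CharP k p] [Field K] [Algebra k K], (⊤ : IntermediateField k K).FG → ∀ O : ValuationSubring K, (∀ c : k, algebraMap k K c ∈ O) → ∃ (A : Subalgebra k K) (h : A.toSubring ≤ O.toSubring), A.FG ∧ IsFractionRing A K ∧ IsRegularLocalRing (Localization.AtPrime (Ideal.comap (Subring.inclusion h) (IsLocalRing.maximalIdeal O)))) → Literature.AlgebraicGeometry.Resolution.ResolutionInChar.{0} p)) → _root_.ResolutionOfSingularities

-- records of items no longer active in this route (dropped / restated):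
-- earlier Assembly2 (stmt-ResolutionOfSingularities-1031, dropped 2026-08-16T14:43:06Z): proved by Literature.AlgGeom.cyclicCovers_assembly_of_reduction — (∀ p : ℕ, p.Prime → (∀ (k K L : Type) [Field k] [CharP k p] [Field K] [Field L] [Algebra k K] [Algebra K L] [Algebra k L] [IsScalarTower k K L], (⊤ : IntermediateField k K).FG → Module.finrank K L = p → (IsGalois K L ∨ IsPurelyInseparable K L) → ∀

/-! D-0027 §2.1 — DECIDING THEOREM (planner-authored via `route open/edit --closes-file`; by planner-plan-ResolutionOfSingularities-g2-0 2026-08-15T19:45:18Z):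
its hypotheses are this route's items and its conclusion the sub-problem Statement (glue_lint), and it elaborates with this file. -/

/-- DECIDING THEOREM of route CyclicCovers (D-0027 §2.1; tenure g2 pivot 2026-08-15): Abhyankar's
ramification-theoretic strategy, dimension-free and relative. The Artin–Schreier ascent `AsAscentRel`,
embedded local uniformization in regular models `EluRegular` and, for every prime `p`, the purely
inseparable step `LuAlphaPTorsor` (= Valuative stmt-0641) give relative local uniformization `LUrel_p`
by `AbhyankarReduction` (CossartPiltant2008 Thm 7.2 with '3' erased); `PatchingRel` (= Valuative
stmt-0642) turns `LUrel_p` into `ResolutionInChar p`; the summit is `∀ p prime, ResolutionInChar p`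
(`ResolutionOfSingularities_iff`). Pure logic. -/
@[closes "route-ResolutionOfSingularities-CyclicCovers"] theorem closes (hAS : AsAscentRel) (hPI : LuAlphaPTorsor) (hElu : EluRegular)
    (hRed : AbhyankarReduction) (hPatch : PatchingRel) :
    _root_.ResolutionOfSingularities :=
  _root_.ResolutionOfSingularities_iff.mpr fun p hp =>
    hPatch p hp (hRed hAS hElu p hp (hPI p hp))

end Summit.ResolutionOfSingularities.ResolutionOfSingularities.Theses.CyclicCovers
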